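/-
Copyright (c) 2026 the pub-hodgecm-mathlib formalisation cell (harness21).  Prover seat hodgecm-mathlib-R90-C133-p03 (g2), Track B ∕ K2-LIT ∕ R90-TF section S5; W3 of the
S5 dealer R90-C133-plan (g2)'s deal 2026-09-04T23:06:50Z (c) ∕ 23:11:26Z (LEAD #33 (B) U-twin cascade): the spectral `H`-packet of a one-dimensional automorphic `ξ`
OVER THE SATISFIABLE KIT LAW (ℓ8ᵁ) `OneDimHLawU` — additive twins of ★ p862138 `R90S5SpectralPacketHOfOneDim` with `rhoXi h8 ↦ rhoXiU h8U` (★ `R90S4OneDimHLawU`).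
-/
import Summits.HodgeConjecture.HodgeConjecture.Theorems.R90S5SpectralPacketHOfOneDim   -- ★ p862138 (K2E1-p12): `spectralPacketHOfOneDim h8 …`, `IsOneDimH` (kit-law-free), `piTwoOfOneDim`∕`chiOneOfOneDim` + their occurrence theorems (h8-free, REUSED BY NAME)
import Summits.HodgeConjecture.HodgeConjecture.Theorems.R90S4OneDimHLawU              -- ★ (this seat, W1): `OneDimHLawU`, `OneDimHLaw.toU`, `GlobalPacketH.rhoXiU h8U ξ` (+ `rhoXiU_isCharPacket`, `memH_rhoXiU_loc`, `eq_rhoXiU_of_isCharPacket`, `rhoXiU_toU_eq_rhoXi`)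
import HarnessLib

/-!
# R90-TF · S5 — W3 `R90S5SpectralPacketHOfOneDimU`: the SPECTRAL `H`-PACKET OF A ONE-DIMENSIONAL AUTOMORPHIC `ξ` over (ℓ8ᵁ) `OneDimHLawU` — constructor, `IsOneDimH`
# characterisations, and the discharge of its discreteness at the record's shape (U-twins of ★ p862138, `rhoXi h8 ↦ rhoXiU h8U`)

Cell `hodgecm-mathlib`, crux H413 (`stmt-HodgeConjecture-24833`), route of record `HCCMUnconditional`; programme R90-TF, section S5 (Rogawski Ch. 13.3); deal of the S5 dealer
R90-C133-plan (g2) 2026-09-04T23:06:50Z (c) «W3 = additive twins of ★ p862138 over `h8U`», hand R90-C133-p03 (g2).  DEFINITION lane (two `def`s WITH BODY — the named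
constructor `spectralPacketHOfOneDimU` and its image-form variant are unavoidable twins of ★ p862138's `def`s — + theorems); `--supports stmt-HodgeConjecture-24833 --as helper`.
No instance, no notation, no named fact, no `sorry`; L9: NO `Lines` import.  ★ p862138 and ★ `F0P3SpectralPacketXi` UNTOUCHED; the kit-law-free declarations of ★ p862138
(`IsOneDimH`, `isOneDimH_iff`, `IsOneDimH.exists_memH_eq_singleton`, `piTwoOfOneDim`, `chiOneOfOneDim`, `isOpen_ker_chiOneOfOneDim`, `boxChar_chiOneOfOneDim_piTwoOfOneDim`,
`cmOccursInDiscreteSpectrum_piTwoOfOneDim`, `cmOccursInDiscreteSpectrum_chiOneOfOneDim`, the «no AFA» finite-component theorems) are REUSED BY NAME, not retyped.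

WHY (S5-audit1 A2 FINDING 22:29:06Z; LEAD #33 (B); ★ W1 `R90S4OneDimHLawU`): the binder `h8 : ∀ v, (𝔩 v).OneDimHLaw` of ★ p862138 is UNSATISFIABLE at the kit of record (split
places carry non-unitary smooth characters of `H_v`); every consumer needs the law only at `r = ℂ_{ξ_v}`, unitary (★ (U-2ξ)).  These twins replace `h8` by the satisfiable
`h8U : ∀ v, (𝔩 v).OneDimHLawU` and `rhoXi h8 ξ` by ★ `rhoXiU h8U ξ` (whose `hu` is discharged inside); proofs are ★ p862138's, token for token, with ★ `memH_rhoXiU_loc` ∕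
`rhoXiU_isCharPacket` ∕ `eq_rhoXiU_of_isCharPacket`.  CONSUMERS (by name): K2E1-typ1's C2 ED. 2b (`packetHOfOneDimU ξ := spectralPacketHOfOneDimU h8U ξ (archH …) (hunrU ξ)
(discH_shape_rhoXiU …)`), S10-F ED. 2, D ED. 4′.
* §1 **`spectralPacketHOfOneDimU h8U ξ Pinf hunr hdisc`** := `⟨rhoXiU h8U ξ, Pinf, hunr, hdisc⟩` + `_fin`∕`_inf` (rfl), `memH_…_fin_loc`, the image-form constructor; **`IsOneDimH ρ ↔
  ∃ ξ, ρ.fin = rhoXiU h8U ξ`** under (ℓ8ᵁ), the dealer's shape `↔ ∃ ξ hunr hdisc, ρ = spectralPacketHOfOneDimU h8U ξ ρ.inf hunr hdisc`, `isOneDimH_spectralPacketHOfOneDimU`;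
  COMPAT `spectralPacketHOfOneDimU_fin_toU` (under (ℓ8): the finite part IS ★ `rhoXi h8 ξ`, via ★ `rhoXiU_toU_eq_rhoXi`).
* §2 `boxChar_…_mem_memH_rhoXiU` and the UNIQUENESS of the realising pair at `rhoXiU`.
* §3 `isRealisedH_shape_rhoXiU`, **`discH_shape_rhoXiU`**, **`eq_archH_of_discH_shapeU`** — the bodies of S5-C's `IsRealisedH` ∕ `discHOfRecord` at `rhoXiU h8U ξ`, token for token.
HONEST LABEL: nothing here closes S5#2∕S5#4; binder-currency repair, count-neutral; REL ≠ ★ ≠ BUILT; HC_CM is proved only modulo the 7 printed citations (2 remaining named inputs: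
hLiu418 = stmt-HodgeConjecture-24832, h413 = stmt-HodgeConjecture-24833) until rung 0 closes.

## References
* [Rogawski1990] J. D. Rogawski, *Automorphic Representations of Unitary Groups in Three Variables*, Ann. of Math. Stud. 123 (1990), §12.1 p. 171 (type (3)); §13.1 p. 199; §13.3 pp. 202–203.
* [BorelJacquet1979] A. Borel, H. Jacquet, *Automorphic forms and automorphic representations*, PSPM 33.1 (1979), §4.6.
* [BushnellHenniart2006] C. J. Bushnell, G. Henniart, *The Local Langlands Conjecture for GL(2)* (2006), §1.1, §9.1, §11.1.
-/

set_option autoImplicit false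
-- the mandated namespace repeats the single-problem summit's segment (`HodgeConjecture.HodgeConjecture`), as in every sibling `R90S5*` file
set_option linter.dupNamespace false

noncomputable section

open NumberField IsDedekindDomain MeasureTheory Filter
open scoped Matrix
open Literature.NumberTheory Literature.NumberTheory.Automorphic Literature.NumberTheory.Automorphic.UnitaryGroup
open Literature.NumberTheory.Rogawski1990 Literature.NumberTheory.GaloisRepresentations
open Summit.HodgeConjecture.HodgeConjecture.Cruxes.H413
open Summit.HodgeConjecture.HodgeConjecture.Cruxes.H413.F0P3LocalPacketKit
open Summit.HodgeConjecture.HodgeConjecture.Cruxes.H413.F0P3GlobalPacket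
open Summit.HodgeConjecture.HodgeConjecture.Cruxes.H413.F0P3GlobalPacketDiscrete
open Summit.HodgeConjecture.HodgeConjecture.Cruxes.H413.F0P3ArchPacketKit
open Summit.HodgeConjecture.HodgeConjecture.Cruxes.H413.F0P3SpectralPacket

namespace Summit.HodgeConjecture.HodgeConjecture.R90.S5

variable {L : Type} [Field L] [NumberField L] [IsCMField L] {H' : Matrix (Fin 3) (Fin 3) L}
  {𝔩 : ∀ v : HeightOneSpectrum (𝓞 ↥(maximalRealSubfield L)), LocalPacketKit L H' v} {𝔞 : ArchPacketKit} {𝔞H : ArchPacketKitH 𝔞}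
  {DiscH : GlobalPacketH 𝔩 → 𝔞H.PktInfH → Prop}

/-! ## §1 The constructor and `IsOneDimH` [§12.1 type (3); §13.1 p. 199; §13.3 p. 203] -/

/-- **`spectralPacketHOfOneDimU h8U ξ Pinf hunr hdisc` — THE SPECTRAL `H`-PACKET OF THE ONE-DIMENSIONAL AUTOMORPHIC `ξ`**: finite part the singleton packet family `{⟦ξ_v⟧}_v`
(★ `GlobalPacketH.rhoXiU h8U ξ`, under the SATISFIABLE kit law (ℓ8ᵁ) `OneDimHLawU` «unitarizable one-dimensional representations of `H_v` are L-packets of cardinality one»), archimedean packet `Pinf`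
(a parameter of the abstract datum `𝔞H`), cofinite unramifiedness of `ξ_H(ξ_v)` (`hunr`, a fact about the kit's data), and the discreteness witness `hdisc : DiscH (rhoXiU h8U ξ) Pinf`.
[cite: Rogawski1990, §12.1 p. 171; §13.1 p. 199; §13.3 p. 203] -/
def spectralPacketHOfOneDimU (h8U : ∀ v : HeightOneSpectrum (𝓞 ↥(maximalRealSubfield L)), (𝔩 v).OneDimHLawU) (ξ : OneDimAutRepH L) (Pinf : 𝔞H.PktInfH)
    (hunr : ∀ᶠ v : HeightOneSpectrum (𝓞 ↥(maximalRealSubfield L)) in cofinite, (𝔩 v).unr ((𝔩 v).xiH ((GlobalPacketH.rhoXiU h8U ξ).loc v)))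
    (hdisc : DiscH (GlobalPacketH.rhoXiU h8U ξ) Pinf) : SpectralPacketH 𝔩 𝔞 𝔞H DiscH :=
  ⟨GlobalPacketH.rhoXiU h8U ξ, Pinf, hunr, hdisc⟩

/-- The finite part of `spectralPacketHOfOneDimU` is `rhoXiU h8U ξ` (`rfl`). [cite: Rogawski1990, §13.1 p. 199] -/
@[simp] theorem spectralPacketHOfOneDimU_fin (h8U : ∀ v : HeightOneSpectrum (𝓞 ↥(maximalRealSubfield L)), (𝔩 v).OneDimHLawU) (ξ : OneDimAutRepH L) (Pinf : 𝔞H.PktInfH)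
    (hunr : ∀ᶠ v : HeightOneSpectrum (𝓞 ↥(maximalRealSubfield L)) in cofinite, (𝔩 v).unr ((𝔩 v).xiH ((GlobalPacketH.rhoXiU h8U ξ).loc v)))
    (hdisc : DiscH (GlobalPacketH.rhoXiU h8U ξ) Pinf) : (spectralPacketHOfOneDimU h8U ξ Pinf hunr hdisc).fin = GlobalPacketH.rhoXiU h8U ξ :=
  rfl

/-- The archimedean packet of `spectralPacketHOfOneDimU` is the given `Pinf` (`rfl`). [cite: Rogawski1990, §12.1 p. 171] -/
@[simp] theorem spectralPacketHOfOneDimU_inf (h8U : ∀ v : HeightOneSpectrum (𝓞 ↥(maximalRealSubfield L)), (𝔩 v).OneDimHLawU) (ξ : OneDimAutRepH L) (Pinf : 𝔞H.PktInfH)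
    (hunr : ∀ᶠ v : HeightOneSpectrum (𝓞 ↥(maximalRealSubfield L)) in cofinite, (𝔩 v).unr ((𝔩 v).xiH ((GlobalPacketH.rhoXiU h8U ξ).loc v)))
    (hdisc : DiscH (GlobalPacketH.rhoXiU h8U ξ) Pinf) : (spectralPacketHOfOneDimU h8U ξ Pinf hunr hdisc).inf = Pinf :=
  rfl

/-- The member set of `(spectralPacketHOfOneDimU …)_v` is the singleton `{⟦ξ_v⟧}` (★ `memH_rhoXiU_loc`). [cite: Rogawski1990, §12.1 p. 171; §13.1 p. 199] -/
theorem memH_spectralPacketHOfOneDimU_fin_loc (h8U : ∀ v : HeightOneSpectrum (𝓞 ↥(maximalRealSubfield L)), (𝔩 v).OneDimHLawU) (ξ : OneDimAutRepH L) (Pinf : 𝔞H.PktInfH)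
    (hunr : ∀ᶠ v : HeightOneSpectrum (𝓞 ↥(maximalRealSubfield L)) in cofinite, (𝔩 v).unr ((𝔩 v).xiH ((GlobalPacketH.rhoXiU h8U ξ).loc v)))
    (hdisc : DiscH (GlobalPacketH.rhoXiU h8U ξ) Pinf) (v : HeightOneSpectrum (𝓞 ↥(maximalRealSubfield L))) :
    (𝔩 v).memH ((spectralPacketHOfOneDimU h8U ξ Pinf hunr hdisc).fin.loc v) =
      {IrrClass.mk (SmoothIrrep.ofChar (ξ.xiLocalChar v) (F0P3XiLocalCharOpenKernel.isOpen_ker_xiLocalChar L ξ v))} :=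
  GlobalPacketH.memH_rhoXiU_loc h8U ξ v

/-- **The unramifiedness binder in IMAGE form**: if a `G`-side global packet `Pg` IS `ξ_H(rhoXiU h8U ξ)` placewise (★ `GlobalPacket.IsImageOf`), its own cofinite-unramified clause gives
`hunr` (the pattern of ★ `F0P3SpectralPacketNValueOfRigidityH` :196). [cite: Rogawski1990, §13.1 p. 199; §13.3 p. 203 ¶2] -/
theorem eventually_unr_xiH_rhoXiU_of_isImageOf (h8U : ∀ v : HeightOneSpectrum (𝓞 ↥(maximalRealSubfield L)), (𝔩 v).OneDimHLawU) (ξ : OneDimAutRepH L)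
    (Pg : GlobalPacket 𝔩) (himg : Pg.IsImageOf (GlobalPacketH.rhoXiU h8U ξ)) :
    ∀ᶠ v : HeightOneSpectrum (𝓞 ↥(maximalRealSubfield L)) in cofinite, (𝔩 v).unr ((𝔩 v).xiH ((GlobalPacketH.rhoXiU h8U ξ).loc v)) :=
  Pg.cofinite_unr.mono fun v hv => by rw [himg v]; exact hv

/-- **`spectralPacketHOfOneDimOfImageU`** — the constructor with the unramifiedness binder in IMAGE form. [cite: Rogawski1990, §13.1 p. 199; §13.3 p. 203 ¶2] -/
def spectralPacketHOfOneDimOfImageU (h8U : ∀ v : HeightOneSpectrum (𝓞 ↥(maximalRealSubfield L)), (𝔩 v).OneDimHLawU) (ξ : OneDimAutRepH L) (Pinf : 𝔞H.PktInfH)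
    (Pg : GlobalPacket 𝔩) (himg : Pg.IsImageOf (GlobalPacketH.rhoXiU h8U ξ)) (hdisc : DiscH (GlobalPacketH.rhoXiU h8U ξ) Pinf) : SpectralPacketH 𝔩 𝔞 𝔞H DiscH :=
  spectralPacketHOfOneDimU h8U ξ Pinf (eventually_unr_xiH_rhoXiU_of_isImageOf h8U ξ Pg himg) hdisc

/-- `spectralPacketHOfOneDimOfImageU` is `spectralPacketHOfOneDim` at the derived `hunr` (`rfl`). [cite: Rogawski1990, §13.1 p. 199] -/
theorem spectralPacketHOfOneDimOfImageU_eq (h8U : ∀ v : HeightOneSpectrum (𝓞 ↥(maximalRealSubfield L)), (𝔩 v).OneDimHLawU) (ξ : OneDimAutRepH L) (Pinf : 𝔞H.PktInfH)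
    (Pg : GlobalPacket 𝔩) (himg : Pg.IsImageOf (GlobalPacketH.rhoXiU h8U ξ)) (hdisc : DiscH (GlobalPacketH.rhoXiU h8U ξ) Pinf) :
    spectralPacketHOfOneDimOfImageU h8U ξ Pinf Pg himg hdisc = spectralPacketHOfOneDimU h8U ξ Pinf (eventually_unr_xiH_rhoXiU_of_isImageOf h8U ξ Pg himg) hdisc :=
  rfl

/-- **Under (ℓ8ᵁ): `IsOneDimH ρ ↔ ∃ ξ, ρ.fin = rhoXiU h8U ξ`** (★ `eq_rhoXiU_of_isCharPacket` ∕ ★ `rhoXiU_isCharPacket`). [cite: Rogawski1990, §12.1 p. 171; §13.1 p. 199] -/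
theorem isOneDimH_iff_exists_fin_eq_rhoXiU (h8U : ∀ v : HeightOneSpectrum (𝓞 ↥(maximalRealSubfield L)), (𝔩 v).OneDimHLawU) (ρ : SpectralPacketH 𝔩 𝔞 𝔞H DiscH) :
    IsOneDimH ρ ↔ ∃ ξ : OneDimAutRepH L, ρ.fin = GlobalPacketH.rhoXiU h8U ξ :=
  ⟨fun ⟨ξ, hξ⟩ => ⟨ξ, GlobalPacketH.eq_rhoXiU_of_isCharPacket h8U ξ hξ⟩, fun ⟨ξ, hξ⟩ => ⟨ξ, hξ ▸ GlobalPacketH.rhoXiU_isCharPacket h8U ξ⟩⟩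

/-- **The dealer's shape: `IsOneDimH ρ ↔ ∃ ξ hunr hdisc, ρ = spectralPacketHOfOneDimU h8U ξ ρ.inf hunr hdisc`** (the archimedean slot is `ρ`'s own; the two proof fields are
determined). [cite: Rogawski1990, §13.3 p. 203] -/
theorem isOneDimH_iff_exists_eq_spectralPacketHOfOneDimU (h8U : ∀ v : HeightOneSpectrum (𝓞 ↥(maximalRealSubfield L)), (𝔩 v).OneDimHLawU)
    (ρ : SpectralPacketH 𝔩 𝔞 𝔞H DiscH) :
    IsOneDimH ρ ↔ ∃ (ξ : OneDimAutRepH L)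
      (hunr : ∀ᶠ v : HeightOneSpectrum (𝓞 ↥(maximalRealSubfield L)) in cofinite, (𝔩 v).unr ((𝔩 v).xiH ((GlobalPacketH.rhoXiU h8U ξ).loc v)))
      (hdisc : DiscH (GlobalPacketH.rhoXiU h8U ξ) ρ.inf), ρ = spectralPacketHOfOneDimU h8U ξ ρ.inf hunr hdisc := by
  rw [isOneDimH_iff_exists_fin_eq_rhoXiU h8U]
  constructor
  · rintro ⟨ξ, hξ⟩
    obtain ⟨fin, inf, hcof, hd⟩ := ρ
    subst hξ
    exact ⟨ξ, hcof, hd, rfl⟩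
  · rintro ⟨ξ, hunr, hdisc, h⟩
    exact ⟨ξ, by rw [h]; rfl⟩

/-- `spectralPacketHOfOneDimU h8U ξ …` is one-dimensional in the sense of `IsOneDimH`. [cite: Rogawski1990, §13.3 p. 203] -/
theorem isOneDimH_spectralPacketHOfOneDimU (h8U : ∀ v : HeightOneSpectrum (𝓞 ↥(maximalRealSubfield L)), (𝔩 v).OneDimHLawU) (ξ : OneDimAutRepH L) (Pinf : 𝔞H.PktInfH)
    (hunr : ∀ᶠ v : HeightOneSpectrum (𝓞 ↥(maximalRealSubfield L)) in cofinite, (𝔩 v).unr ((𝔩 v).xiH ((GlobalPacketH.rhoXiU h8U ξ).loc v)))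
    (hdisc : DiscH (GlobalPacketH.rhoXiU h8U ξ) Pinf) : IsOneDimH (spectralPacketHOfOneDimU h8U ξ Pinf hunr hdisc) :=
  ⟨ξ, GlobalPacketH.rhoXiU_isCharPacket h8U ξ⟩


/-- **COMPATIBILITY with ★ p862138**: under the strong law (ℓ8) (via `toU`), the finite part of the U-constructor IS ★ `rhoXi h8 ξ` (★ `rhoXiU_toU_eq_rhoXi`) — Old → New is a
`rw` for C2 ED. 2b's `example`s. [cite: Rogawski1990, §12.1 p. 171] -/
theorem spectralPacketHOfOneDimU_fin_toU (h8 : ∀ v : HeightOneSpectrum (𝓞 ↥(maximalRealSubfield L)), (𝔩 v).OneDimHLaw) (ξ : OneDimAutRepH L) (Pinf : 𝔞H.PktInfH)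
    (hunr : ∀ᶠ v : HeightOneSpectrum (𝓞 ↥(maximalRealSubfield L)) in cofinite,
      (𝔩 v).unr ((𝔩 v).xiH ((GlobalPacketH.rhoXiU (fun v => (h8 v).toU) ξ).loc v)))
    (hdisc : DiscH (GlobalPacketH.rhoXiU (fun v => (h8 v).toU) ξ) Pinf) :
    (spectralPacketHOfOneDimU (fun v => (h8 v).toU) ξ Pinf hunr hdisc).fin = GlobalPacketH.rhoXi h8 ξ :=
  GlobalPacketH.rhoXiU_toU_eq_rhoXi h8 ξ

end Summit.HodgeConjecture.HodgeConjecture.R90.S5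

namespace Summit.HodgeConjecture.HodgeConjecture.R90.S5

section CM

variable {L : Type} [Field L] [NumberField L] [IsCMField L]

variable {H' : Matrix (Fin 3) (Fin 3) L} {𝔩 : ∀ v : HeightOneSpectrum (𝓞 ↥(maximalRealSubfield L)), LocalPacketKit L H' v}

/-- **`⟦piTwoOfOneDim ξ v⟧ ⊠ chiOneOfOneDim ξ v ∈ (rhoXiU h8U ξ)_v = {⟦ξ_v⟧}`** — the membership clause of S5-C's `IsRealisedH` at `ξ`'s packet (★ `memH_rhoXiU_loc`).
[cite: Rogawski1990, §13.3 p. 202; §12.1 p. 171] -/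
theorem boxChar_chiOneOfOneDim_piTwoOfOneDim_mem_memH_rhoXiU (h8U : ∀ v : HeightOneSpectrum (𝓞 ↥(maximalRealSubfield L)), (𝔩 v).OneDimHLawU) (ξ : OneDimAutRepH L)
    (v : HeightOneSpectrum (𝓞 ↥(maximalRealSubfield L))) :
    IrrClass.boxChar (chiOneOfOneDim ξ v) (isOpen_ker_chiOneOfOneDim ξ v) (piTwoOfOneDim ξ v) ∈ (𝔩 v).memH ((GlobalPacketH.rhoXiU h8U ξ).loc v) := by
  rw [GlobalPacketH.memH_rhoXiU_loc h8U ξ v, boxChar_chiOneOfOneDim_piTwoOfOneDim, Finset.mem_singleton]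

/-- **UNIQUENESS OF THE REALISING PAIR**: if `π₂,v ⊠ χ₁,v ∈ (rhoXiU h8U ξ)_v = {⟦ξ_v⟧}` at every `v`, then `π₂ = piTwoOfOneDim ξ` and `χ₁ = chiOneOfOneDim ξ` (★ `IrrClass.boxChar_eq_boxChar_iff`:
`⊠` is injective on classes AND characters). [cite: Rogawski1990, §12.1 p. 171] [cite: BushnellHenniart2006, §9.1] -/
theorem eq_piTwoOfOneDim_and_eq_chiOneOfOneDim_of_boxChar_mem_rhoXiU (h8U : ∀ v : HeightOneSpectrum (𝓞 ↥(maximalRealSubfield L)), (𝔩 v).OneDimHLawU) (ξ : OneDimAutRepH L)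
    {π₂ : ∀ v : HeightOneSpectrum (𝓞 ↥(maximalRealSubfield L)), IrrClass ((cmDatum L 2 (Matrix.of fun i j : Fin 2 => if i.val + j.val + 1 = 2 then (1 : L) else 0)).Local v)}
    {χ₁ : ∀ v : HeightOneSpectrum (𝓞 ↥(maximalRealSubfield L)), ((cmDatum L 1 (Matrix.of fun i j : Fin 1 => if i.val + j.val + 1 = 1 then (1 : L) else 0)).Local v) →* ℂˣ}
    {hχ₁ : ∀ v : HeightOneSpectrum (𝓞 ↥(maximalRealSubfield L)),
      IsOpen (((χ₁ v).ker : Subgroup ((cmDatum L 1 (Matrix.of fun i j : Fin 1 => if i.val + j.val + 1 = 1 then (1 : L) else 0)).Local v)) :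
        Set ((cmDatum L 1 (Matrix.of fun i j : Fin 1 => if i.val + j.val + 1 = 1 then (1 : L) else 0)).Local v))}
    (hmem : ∀ v : HeightOneSpectrum (𝓞 ↥(maximalRealSubfield L)), IrrClass.boxChar (χ₁ v) (hχ₁ v) (π₂ v) ∈ (𝔩 v).memH ((GlobalPacketH.rhoXiU h8U ξ).loc v)) :
    π₂ = piTwoOfOneDim ξ ∧ χ₁ = chiOneOfOneDim ξ := by
  have key : ∀ v : HeightOneSpectrum (𝓞 ↥(maximalRealSubfield L)), π₂ v = piTwoOfOneDim ξ v ∧ χ₁ v = chiOneOfOneDim ξ v := fun v => by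
    have h := hmem v
    rw [GlobalPacketH.memH_rhoXiU_loc h8U ξ v, Finset.mem_singleton, ← boxChar_chiOneOfOneDim_piTwoOfOneDim ξ v] at h
    exact (IrrClass.boxChar_eq_boxChar_iff (hχ₁ v) (isOpen_ker_chiOneOfOneDim ξ v)).1 h
  exact ⟨funext fun v => (key v).1, funext fun v => (key v).2⟩

/-! ## §3 The discharge at the record's shape (`IsRealisedH` ∕ `discHOfRecord` unfolded; `archH` a parameter) [§13.3 pp. 202–203] -/

variable
  (μ₂ : Measure (adelicGroupData (↥(maximalRealSubfield L)) L (IsCMField.complexConj L) 2 (Matrix.of fun i j : Fin 2 => if i.val + j.val + 1 = 2 then (1 : L) else 0)).automorphicQuotient)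
  [(adelicGroupData (↥(maximalRealSubfield L)) L (IsCMField.complexConj L) 2 (Matrix.of fun i j : Fin 2 => if i.val + j.val + 1 = 2 then (1 : L) else 0)).IsAutomorphicMeasure μ₂]
  (μ₁ : Measure (adelicGroupData (↥(maximalRealSubfield L)) L (IsCMField.complexConj L) 1 (Matrix.of fun i j : Fin 1 => if i.val + j.val + 1 = 1 then (1 : L) else 0)).automorphicQuotient)
  [(adelicGroupData (↥(maximalRealSubfield L)) L (IsCMField.complexConj L) 1 (Matrix.of fun i j : Fin 1 => if i.val + j.val + 1 = 1 then (1 : L) else 0)).IsAutomorphicMeasure μ₁]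

/-- **`IsRealisedH 𝔩 μ₂ μ₁ (rhoXiU h8U ξ) (piTwoOfOneDim ξ) (chiOneOfOneDim ξ) _` — ITS BODY, TOKEN FOR TOKEN** (S5-C :95): the pair `(piTwoOfOneDim ξ, chiOneOfOneDim ξ)` realises `ξ`'s packet in
`L²_disc(U(Φ₂), μ₂) ⊗ L²_disc(U(Φ₁), μ₁)`. [cite: Rogawski1990, §13.3 pp. 202–203; §12.1 p. 171] -/
theorem isRealisedH_shape_rhoXiU (h8U : ∀ v : HeightOneSpectrum (𝓞 ↥(maximalRealSubfield L)), (𝔩 v).OneDimHLawU) (ξ : OneDimAutRepH L) :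
    cmOccursInDiscreteSpectrum L 2 (Matrix.of fun i j : Fin 2 => if i.val + j.val + 1 = 2 then (1 : L) else 0) μ₂ (piTwoOfOneDim ξ) ∧
      cmOccursInDiscreteSpectrum L 1 (Matrix.of fun i j : Fin 1 => if i.val + j.val + 1 = 1 then (1 : L) else 0) μ₁
        (fun v => IrrClass.mk (SmoothIrrep.ofChar (chiOneOfOneDim ξ v) (isOpen_ker_chiOneOfOneDim ξ v))) ∧
      ∀ v : HeightOneSpectrum (𝓞 ↥(maximalRealSubfield L)),
        IrrClass.boxChar (chiOneOfOneDim ξ v) (isOpen_ker_chiOneOfOneDim ξ v) (piTwoOfOneDim ξ v) ∈ (𝔩 v).memH ((GlobalPacketH.rhoXiU h8U ξ).loc v) :=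
  ⟨cmOccursInDiscreteSpectrum_piTwoOfOneDim μ₂ ξ, cmOccursInDiscreteSpectrum_chiOneOfOneDim μ₁ ξ, boxChar_chiOneOfOneDim_piTwoOfOneDim_mem_memH_rhoXiU h8U ξ⟩

variable {𝔞 : ArchPacketKit} {𝔞H : ArchPacketKitH 𝔞}

/-- **`discHOfRecord 𝔩 𝔞H μ₂ μ₁ archH (rhoXiU h8U ξ) (archH (piTwoOfOneDim ξ) (chiOneOfOneDim ξ))` — ITS BODY, TOKEN FOR TOKEN** (S5-C :112): `ξ`'s packet, with the archimedean packet
`archH` OF ITS OWN REALISING PAIR, is a DISCRETE `H`-packet of record.  This is the `hdisc` of C ED. 5's `packetHOfOneDim ξ := spectralPacketHOfOneDimU h8U ξ (archH (piTwoOfOneDim ξ) (chiOneOfOneDim ξ)) (hunr ξ) ‹this›`.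
[cite: Rogawski1990, §13.3 pp. 202–203] -/
theorem discH_shape_rhoXiU (h8U : ∀ v : HeightOneSpectrum (𝓞 ↥(maximalRealSubfield L)), (𝔩 v).OneDimHLawU)
    (archH : (∀ v : HeightOneSpectrum (𝓞 ↥(maximalRealSubfield L)), IrrClass ((cmDatum L 2 (Matrix.of fun i j : Fin 2 => if i.val + j.val + 1 = 2 then (1 : L) else 0)).Local v)) →
      (∀ v : HeightOneSpectrum (𝓞 ↥(maximalRealSubfield L)), ((cmDatum L 1 (Matrix.of fun i j : Fin 1 => if i.val + j.val + 1 = 1 then (1 : L) else 0)).Local v) →* ℂˣ) → 𝔞H.PktInfH)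
    (ξ : OneDimAutRepH L) :
    ∃ (π₂ : ∀ v : HeightOneSpectrum (𝓞 ↥(maximalRealSubfield L)), IrrClass ((cmDatum L 2 (Matrix.of fun i j : Fin 2 => if i.val + j.val + 1 = 2 then (1 : L) else 0)).Local v))
      (χ₁ : ∀ v : HeightOneSpectrum (𝓞 ↥(maximalRealSubfield L)), ((cmDatum L 1 (Matrix.of fun i j : Fin 1 => if i.val + j.val + 1 = 1 then (1 : L) else 0)).Local v) →* ℂˣ)
      (hχ₁ : ∀ v : HeightOneSpectrum (𝓞 ↥(maximalRealSubfield L)),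
        IsOpen (((χ₁ v).ker : Subgroup ((cmDatum L 1 (Matrix.of fun i j : Fin 1 => if i.val + j.val + 1 = 1 then (1 : L) else 0)).Local v)) :
          Set ((cmDatum L 1 (Matrix.of fun i j : Fin 1 => if i.val + j.val + 1 = 1 then (1 : L) else 0)).Local v))),
      (cmOccursInDiscreteSpectrum L 2 (Matrix.of fun i j : Fin 2 => if i.val + j.val + 1 = 2 then (1 : L) else 0) μ₂ π₂ ∧
        cmOccursInDiscreteSpectrum L 1 (Matrix.of fun i j : Fin 1 => if i.val + j.val + 1 = 1 then (1 : L) else 0) μ₁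
          (fun v => IrrClass.mk (SmoothIrrep.ofChar (χ₁ v) (hχ₁ v))) ∧
        ∀ v : HeightOneSpectrum (𝓞 ↥(maximalRealSubfield L)), IrrClass.boxChar (χ₁ v) (hχ₁ v) (π₂ v) ∈ (𝔩 v).memH ((GlobalPacketH.rhoXiU h8U ξ).loc v)) ∧
      archH (piTwoOfOneDim ξ) (chiOneOfOneDim ξ) = archH π₂ χ₁ :=
  ⟨piTwoOfOneDim ξ, chiOneOfOneDim ξ, isOpen_ker_chiOneOfOneDim ξ, isRealisedH_shape_rhoXiU μ₂ μ₁ h8U ξ, rfl⟩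

/-- **UNIQUENESS AT THE RECORD**: if `(rhoXiU h8U ξ, P)` satisfies the body of `discHOfRecord 𝔩 𝔞H μ₂ μ₁ archH` for ANY realising pair, then `P = archH (piTwoOfOneDim ξ) (chiOneOfOneDim ξ)`
(the realising pair of a character packet is unique, §2) — whence at the record `IsOneDimH ρ ↔ ∃ ξ, ρ = packetHOfOneDim ξ`. [cite: Rogawski1990, §13.3 p. 203; §12.1 p. 171] -/
theorem eq_archH_of_discH_shapeU (h8U : ∀ v : HeightOneSpectrum (𝓞 ↥(maximalRealSubfield L)), (𝔩 v).OneDimHLawU)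
    (archH : (∀ v : HeightOneSpectrum (𝓞 ↥(maximalRealSubfield L)), IrrClass ((cmDatum L 2 (Matrix.of fun i j : Fin 2 => if i.val + j.val + 1 = 2 then (1 : L) else 0)).Local v)) →
      (∀ v : HeightOneSpectrum (𝓞 ↥(maximalRealSubfield L)), ((cmDatum L 1 (Matrix.of fun i j : Fin 1 => if i.val + j.val + 1 = 1 then (1 : L) else 0)).Local v) →* ℂˣ) → 𝔞H.PktInfH)
    (ξ : OneDimAutRepH L) {P : 𝔞H.PktInfH}
    (hP : ∃ (π₂ : ∀ v : HeightOneSpectrum (𝓞 ↥(maximalRealSubfield L)), IrrClass ((cmDatum L 2 (Matrix.of fun i j : Fin 2 => if i.val + j.val + 1 = 2 then (1 : L) else 0)).Local v))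
      (χ₁ : ∀ v : HeightOneSpectrum (𝓞 ↥(maximalRealSubfield L)), ((cmDatum L 1 (Matrix.of fun i j : Fin 1 => if i.val + j.val + 1 = 1 then (1 : L) else 0)).Local v) →* ℂˣ)
      (hχ₁ : ∀ v : HeightOneSpectrum (𝓞 ↥(maximalRealSubfield L)),
        IsOpen (((χ₁ v).ker : Subgroup ((cmDatum L 1 (Matrix.of fun i j : Fin 1 => if i.val + j.val + 1 = 1 then (1 : L) else 0)).Local v)) :
          Set ((cmDatum L 1 (Matrix.of fun i j : Fin 1 => if i.val + j.val + 1 = 1 then (1 : L) else 0)).Local v))),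
      (cmOccursInDiscreteSpectrum L 2 (Matrix.of fun i j : Fin 2 => if i.val + j.val + 1 = 2 then (1 : L) else 0) μ₂ π₂ ∧
        cmOccursInDiscreteSpectrum L 1 (Matrix.of fun i j : Fin 1 => if i.val + j.val + 1 = 1 then (1 : L) else 0) μ₁
          (fun v => IrrClass.mk (SmoothIrrep.ofChar (χ₁ v) (hχ₁ v))) ∧
        ∀ v : HeightOneSpectrum (𝓞 ↥(maximalRealSubfield L)), IrrClass.boxChar (χ₁ v) (hχ₁ v) (π₂ v) ∈ (𝔩 v).memH ((GlobalPacketH.rhoXiU h8U ξ).loc v)) ∧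
      P = archH π₂ χ₁) :
    P = archH (piTwoOfOneDim ξ) (chiOneOfOneDim ξ) := by
  obtain ⟨π₂, χ₁, hχ₁, ⟨-, -, hmem⟩, hPe⟩ := hP
  obtain ⟨h₂, h₁⟩ := eq_piTwoOfOneDim_and_eq_chiOneOfOneDim_of_boxChar_mem_rhoXiU h8U ξ hmem
  subst h₂ h₁
  exact hPe

end CM

end Summit.HodgeConjecture.HodgeConjecture.R90.S5

end
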